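import Literature.Probability.RandomPlanarGeometry.CritPercSLESwallowingProofs
import Literature.Probability.RandomPlanarGeometry.SLENotSimplePath
import HarnessLib

/-!
# The self-touching phase `4 < κ < 8` of the SLE trace (Rohde–Schramm (2005), §1): proved

Topic `Probability/RandomPlanarGeometry`; proof sibling of `CritPercSLESelfTouching.lean`. We
**discharge the named fact** `Literature.Probability.RandomPlanarGeometry.ae_isSelfTouching_sleTrace`
(`CritPercSLE.lean`; S. Rohde, O. Schramm, *Basic properties of SLE*, Ann. of Math. 161 (2005),
§1 p. 885 / Thm 6.4: for `4 < κ < 8` the SLE_κ trace is a.s. a self-touching curve — not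
injective, with range of empty interior — in the tree's weak vocabulary
`Loewner.IsSelfTouching`):

* `Literature.Probability.RandomPlanarGeometry.ae_isSelfTouching_sleTrace_holds`.

It is the reduction `ae_isSelfTouching_sleTrace_of_not_injective`
(`CritPercSLESwallowingProofs.lean`: empty interior from Rohde–Schramm's Lemma 6.3, `κ < 8`,
PROVED there as `exists_tendsto_sleDerivRatio_of_lt_eight_holds` — every fixed `z ∈ ℍ` is a.s.
off the trace, hence so is a dense countable set) fed with the a.s. non-injectivity of the trace
for `κ > 4` (`ae_not_injective_sleTrace_holds`, `SLENotSimplePath.lean`: real points near the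
driving point are swallowed at once in the conformal Markov picture, while a simple excursion of
an injective trace into `Hₛ` would swallow nothing, by Janiszewski's theorem).

## References

* S. Rohde, O. Schramm, *Basic properties of SLE*, Ann. of Math. 161 (2005) 883–924
  (arXiv:math/0106036): §1 (p. 885), Lemma 6.3, Thm 6.4.
-/

noncomputable section

open scoped NNReal

namespace Literature.Probability.RandomPlanarGeometry

variable {κ : ℝ≥0}

/-- **Rohde–Schramm (2005), §1 / Thm 6.4 (proved)**: for `4 < κ < 8`, almost surely the SLE_κ
trace is self-touching — not injective (`ae_not_injective_sleTrace_holds`) and with range of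
empty interior (Lemma 6.3, `exists_tendsto_sleDerivRatio_of_lt_eight_holds`). Discharge of the
named fact `ae_isSelfTouching_sleTrace`. [cite: RohdeSchramm2005, §1 p. 885 and Thm 6.4] -/
theorem ae_isSelfTouching_sleTrace_holds : ae_isSelfTouching_sleTrace (κ := κ) :=
  ae_isSelfTouching_sleTrace_of_not_injective ae_not_injective_sleTrace_holds

end Literature.Probability.RandomPlanarGeometry
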